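import Literature.MathematicalPhysics.QuantumFieldTheory.Balaban1983to89.Beta.KKTFluctuationEnergy
import Literature.MathematicalPhysics.QuantumFieldTheory.Balaban1983to89.Beta.ExpKernelCalculus

/-!
# Bałaban's renormalization group, β-function cell (an2, background-field route) — THE PACKED RESOLVENT KERNEL OF ONE BLOCKING
STEP: the `(field, multiplier)` blocks `[[Γ, ℋ], [ℋ♭, 𝒮]]` of the bordered inverse of the typed `U = 1` block-averaging KKT system
(blocking factor `N`; for `N = L^k` this is, at `U = 1`, the `k`-step COMPOSITE system seen from the fine lattice, since block
averagings compose) as ONE `ExpKernelCalculus` matrix kernel, with exponential decay (`Decays`), block-translation invariance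
(`BlockCovariant.covA`), chain-rule vertices from local stencils, and the well-typedness (`AbsMoment₂`) of the resolvent Hessian
kernel `hessKer (KInv N) V W` for EVERY admissible vertex pair `(V, W)`

HONEST FRAMING.  Kernel-checked FOLKLORE (re-indexing, the triangle inequality in `ℓ¹`, and the cell's own decay theorems
`KKTFluctuationKernel.decay_Gam` / `decay_wΓφ`, `KernelSpecInstance.decay_wH` / `decay_wΦ`), written to close the `A`-slot of the
(T-def) item of the `pub-balaban` β-function audit (BETA-SPEC v1.9zz §7.36, RULING (R18-1): the one-step kernels
`Tbal := hessKer A V W` of Bałaban's second-order effective action must be DEFINED `EKer 4`-valued objects with `AbsMoment₂`).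
After this file, for a blocking factor `N`, the propagator entering every one-loop vertex contraction of the typed `U = 1`
system is a single object `KInv N : MKer (d+1) (Fin (d+1) ⊕ Fin (d+1))` and `absMoment₂_hessKer_KInv` discharges the hypothesis
`hTA` of `Beta.HidentScalewise` / `Beta.ScalewiseVectorSeam` for `𝒯 := hessKer (KInv N) V W` and ANY vertex families `(V, W)`
bi-localised at the coarse bonds.  WHICH OF BAŁABAN'S KERNELS THIS SERVES (recorded so that no reader over-reads it): with
`N = L^m` and the `B`-jets of the `m`-step COMPOSITE transformation (composed constraint, composite background minimiser) as
vertex data, `hessKer (KInv (L^m)) V W` is the shape of the ONE-SHOT kernel `𝒯 m` of the cell's `HessianTelescoping`; the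
genuine step-`j` ONE-STEP kernel `T j` (B12 (1.20): «the vacuum polarization tensor of the theory defined by the j-th fluctuation
field integral», whose quadratic form at order `g⁰` is the `j`-step effective operator, not the unit-lattice Wilson form unless
`j = 0`) needs in addition the decimation of the field legs of `KInv (L^{j+1})` to the step-`j` lattice — NOT done in this file.
What it does NOT do either: it does not define Bałaban's vertex data (the `B`-jets of the Wilson Hessian, of the linearised
averaging and of the `J`-term through the background — items (V-Δ), (V-H), (V-J) of the cell; §7's `JetData` is only the socket),
it proves no telescoping ((D1-tel)) and no representation ((D1-rep)), and it does not touch the SIZE statement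
`FlowStep.BetaPertH` / (M2⁺).  Discharging `BetaPertH` would make Bałaban's ultraviolet
stability unconditional — a constructive-QFT statement which is NOT the continuum limit and NOT the Clay Millennium problem;
nothing here is progress on either.

THE MATHEMATICS (B9 = [Balaban1985BackgroundPropagators] (3.10)–(3.12) p. 392, (3.14)–(3.19) p. 393, (3.26)–(3.27) p. 395, and
B12 = [Balaban1987RG1] (1.20)–(1.22) p. 264, read at `U = 1`; v1.1 ERRATUM: v1 of this header mis-numbered these locators as «B9 §1
(1.22)–(1.30), Thm. 1 p. 395» and «B12 §1 (1.17)–(1.21) p. 252–255» — B9 numbers its formulas (3.n) and p. 395 carries the definitions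
(3.26)–(3.27), not a theorem; corrected here after re-reading the pages, no Lean content changed).  One renormalisation step integrates the fine gauge field `A` against the Gaussian measure of the quadratic form `H`
(linearised Wilson action plus gauge term) under the linear constraints "block averages of `A` prescribed" (multiplier `φ`, a
coarse 1-form) and the gauge condition (multiplier `μ`).  The bordered ("KKT") operator of this system is invertible
(`Beta.BlochFibreMatrix`, `Beta.KernelSpecInstance`, `Beta.KKTFluctuationKernel`); its inverse has the blocks
`Γ` = field response to a force (the FLUCTUATION COVARIANCE, `KKTFluctuationKernel.Gam`), `ℋ` = field response to a prescribed
average (Bałaban's minimiser-type kernel, `KernelSpecInstance.wH`), `ℋ♭` = multiplier response to a force (`GamΦ`) and the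
multiplier response to a prescribed average (`wΦ`; minus the effective coarse form `𝒮` in the usual sign convention).  The second
variation in the background of `log` of the one-step normalisation factor is `½ tr(K⁻¹ ∂²K) − ½ tr(K⁻¹ ∂K K⁻¹ ∂K)`
(`ExpKernelCalculus.hessKer` = `½·tadpole − ½·bubble`), where the jets `∂K`, `∂²K` of the bordered operator live on the field AND
the multiplier blocks (the linearised averaging depends on the background through the parallel transports `R(U(Γ_{y,x}))` of the
contour variables, B9 (3.15), (3.19) p. 393); hence the
propagator of the one-loop contractions is the FULL `(field, multiplier)` resolvent, which this file packs into one kernel on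
`ℤ^{d+1}` by carrying the coarse legs at the points `N • y` of the coarse sublattice (zero elsewhere).  CONVENTION (axial
reading, B12 pp. 252–253, (0.11)ff: «a Euclidean invariant definition of the axial gauge fixing» relative to the block trees; p. 255:
Faddeev–Popov factor `1`): the gauge condition of the fluctuation integral is a fixed, background-INDEPENDENT coordinate subspace of
the typed system, so the jets vanish on the gauge-multiplier block and that block is NOT packed; the fibre is a `Sum` type and a
third summand can be added without changing this API should a covariant slice ever be wanted.

CONTENTS (all [folklore]).  §1 `Fib d := Fin (d+1) ⊕ Fin (d+1)`, `KInv : MKer (d+1) (Fib d)` and its block read-outs at coarse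
points (`KInv_inl_inl`, `KInv_inl_inr_coarse`, `KInv_inr_inl_coarse`, `KInv_inr_inr_coarse`, vanishing off the sublattice).
§2 `decays_KInv : ∃ δ C, 0 < δ ∧ 0 ≤ C ∧ Decays (KInv N) C δ` (blockwise: `decay_inl_inl` … `decay_inr_inr`; the multiplier legs
cost a factor `1/N` in the rate via `l1_zsmul_sub_le : |N•q − y|₁ ≤ N |q − quo y|₁ + N(d+1)`; monotonicity `bound_mono`,
`decays_mono`, `biLoc_mono`).  §3 `shiftK_KInv : shiftK (−N•t) (KInv N) = KInv N`, `blockCovariant_KInv` (covariance for any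
covariant vertex families), `KInv_inl_inl_symm` (symmetry of `Γ`, from `KKTFluctuationEnergy.Gam_symm`).  §5 vertices from
LOCAL STENCILS: `wsum` (superposition of a point-indexed kernel family with weights), `biLoc_wsum` (decaying weights × self-localised
stencils ⇒ bi-localised at the centre of the weights, rate `δ/2`), `biLoc_finset_sum`, `wsum_shift`; the CHAIN-RULE VERTEX
`vertexOf S μ y := Σ'_u Σ_{κ′} wH κ′ μ (u − N•y) · S κ′ u` through the `ℋ`-column of `KInv` (`vertexOf_weight`), `vertexFamily_vertexOf`
/ `vertexFamily_vertexOf'` (it IS a `VertexFamily`), `vertexOf_translate` (`covV`).  §6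
`absMoment₂_hessKer_KInv : VertexFamily V N Cv δv → VertexFamily₂ W N Cw δv → 0 < δv → ∀ μ ν, AbsMoment₂ (hessKer (KInv N) V W μ ν)`
and `hess_KInv_eq_hessKer` (general base point).  §7 `JetData` (a local first-order stencil family + an abstract second-order
vertex family — the socket Bałaban's jets are to be delivered into), `TOf J := hessKer (KInv N) (vertexOf J.S) J.W`, `absMoment₂_TOf`,
and in dimension four `hTA_TOf : ∀ j c e, AbsMoment₂ (TOf (J j) c e)` = the hypothesis `hTA` of the cell's endpoint theorems for ANY
scale-indexed jet data.  All rates/constants are existential PER `N`; no uniformity in `N` is claimed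
(none is needed by the (T-def) slot).

Sources (orientation only; every Lean statement below is [folklore] over the cell's typed objects).  [cite: Balaban1985BackgroundPropagators,
(3.10)–(3.12) p. 392 (the operator `Δ^η(U)`, the current `J = D*η⁻² Im ∂U` and the expansion `A^η(exp iηA U) = A^η(U) + ⟨A,J⟩ + ½⟨A,ΔA⟩ + …`
of the Wilson action around a background), (3.14)–(3.16), (3.19) p. 393 (the linearised composite averaging `Q_j(U) = Q(Ū^{j−1})·…·Q(Ū)Q(U)`,
its background dependence through `R(U(Γ_{y,x}))`, the operator `Q*aQ`), (3.26)–(3.27) p. 395 (`Δ_a = Δ + DRD* + Q*aQ`, `G(U) = (Δ_a↾Ω₀)⁻¹`: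
«Understanding regularity and decay properties of these operators is the main subject of the paper»)]; [cite: Balaban1987RG1, (0.11)ff
pp. 252–253 (Euclidean-invariant axial gauge fixing relative to the block trees), (0.17)–(0.20) (the small field renormalization
transformations), (1.20)–(1.22) p. 264 («This is the vacuum polarization tensor of the theory defined by the j-th fluctuation field
integral», `β_{j+1}(g_j) = Σ_x Π_{j+1,μν}(g_j,x) x_μ x_ν` for `μ ≠ ν`)]; textbook background-field one-loop formula
`δ² log det K = tr(K⁻¹δ²K) − tr(K⁻¹δK K⁻¹δK)`: [folklore].  Programme-internal documents are not cited for any mathematical content.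
-/

open Finset
open scoped BigOperators

namespace Literature.MathematicalPhysics.QuantumFieldTheory.Balaban1983to89.Beta.OneStepResolventKernel

open Literature.Probability.LatticeModels (TorusSite Torus.proj Torus.proj_apply)
open LatticeForm (repZ quo proj_repZ proj_add_zsmul)
open BlochFibreUniqueness (quo_add_zsmul quo_repZ)
open BlochFibreMatrix (eq_repZ_add_zsmul_quo repZ_zero)
open KernelSpecInstance (wH wΦ decay_wH decay_wΦ)
open KKTFluctuationKernel (wΓ wΓφ Gam GamΦ decay_Gam decay_wΓφ l1_sub_le l1_repZ_le)
open KKTFluctuationEnergy (Gam_symm tsum_shift)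
open B12Sec2to5 (l1 l1_nonneg Decay510)
open DecimatedMomentSummable (AbsMoment₂)
open ExpKernelCalculus (Decays BiLoc VertexFamily VertexFamily₂ hessKer hess shiftK BlockCovariant
  absMoment₂_hessKer hess_eq_hessKer l1_natSmul l1_sub_triangle Zl Zl_nonneg summable_exp_shift tsum_exp_shift)

variable {d N : ℕ}

/-! ## §1 The fibre and the packed kernel -/

/-- THE FIBRE of the packed one-step resolvent: a fine gauge-field component (`inl κ`, a bond direction at a fine site) or a
constraint-multiplier component (`inr κ`, a coarse bond direction, carried at the fine points `N • y` of the coarse sublattice).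
[folklore] -/
abbrev Fib (d : ℕ) : Type := Fin (d + 1) ⊕ Fin (d + 1)

section Defs

variable [NeZero N]

omit [NeZero N] in
/-- A coarse point `N • u` has zero residue. [folklore] -/
theorem proj_zsmul (u : (Fin (d + 1) → ℤ)) : Torus.proj N ((N : ℤ) • u) = 0 := by
  funext i
  simp only [Torus.proj_apply, Pi.smul_apply, smul_eq_mul, Int.cast_mul, Int.cast_natCast, ZMod.natCast_self, zero_mul,
    Pi.zero_apply]

/-- The block index of a coarse point `N • u` is `u`. [folklore] -/
theorem quo_zsmul (u : (Fin (d + 1) → ℤ)) : quo N ((N : ℤ) • u) = u := by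
  funext j
  simp only [quo, Pi.smul_apply, smul_eq_mul]
  exact Int.mul_ediv_cancel_left _ (by exact_mod_cast NeZero.ne N)


/-- **THE PACKED RESOLVENT KERNEL** `KInv` of the typed `U = 1` block-averaging KKT system of ONE blocking step of factor `N` (for
`N = L^k`: the `k`-step composite system at `U = 1`, block averagings composing exactly), as an
`ExpKernelCalculus` matrix kernel on `ℤ^{d+1}` with fibre `Fib d`: the `(field, multiplier)`-blocks of the bordered inverse,
`(inl κ, inl l) ↦ Γ((κ,x),(l,y))` (`KKTFluctuationKernel.Gam`: force source → field), `(inl κ, inr l) ↦ ℋ` (`KernelSpecInstance.wH`: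
prescribed block average at the coarse bond `(l, y/N)` → field), `(inr κ, inl l) ↦ ℋ♭` (`GamΦ`: force source → constraint multiplier
at the coarse bond `(κ, x/N)`), `(inr κ, inr l) ↦` the multiplier response to a prescribed average (`wΦ`); coarse legs live on the
sublattice `N • ℤ^{d+1}` (test `Torus.proj N · = 0`) and the kernel is `0` off it.  The gauge-multiplier block is deliberately not
packed (axial-slice convention: the gauge rows carry no background dependence). [folklore] -/
noncomputable def KInv : ExpKernelCalculus.MKer (d + 1) (Fib d) := fun x y a b =>
  match a, b with
  | Sum.inl κ, Sum.inl l => Gam (N := N) κ x l y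
  | Sum.inl κ, Sum.inr l => if Torus.proj N y = 0 then wH (N := N) κ l (x - y) else 0
  | Sum.inr κ, Sum.inl l => if Torus.proj N x = 0 then GamΦ (N := N) κ (quo N x) l y else 0
  | Sum.inr κ, Sum.inr l => if Torus.proj N x = 0 ∧ Torus.proj N y = 0 then wΦ (N := N) κ l (quo N x - quo N y) else 0

/-- The field–field block is the fluctuation covariance `Γ`. [folklore] -/
theorem KInv_inl_inl (κ l : Fin (d + 1)) (x y : (Fin (d + 1) → ℤ)) :
    KInv (N := N) x y (Sum.inl κ) (Sum.inl l) = Gam (N := N) κ x l y := rfl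

/-- The field–multiplier block at a coarse point `N • y'` is the minimiser-type kernel `wH`. [folklore] -/
theorem KInv_inl_inr_coarse (κ l : Fin (d + 1)) (x y' : (Fin (d + 1) → ℤ)) :
    KInv (N := N) x ((N : ℤ) • y') (Sum.inl κ) (Sum.inr l) = wH (N := N) κ l (x - (N : ℤ) • y') := by
  simp only [KInv, proj_zsmul, if_true]

/-- The multiplier–field block at a coarse point `N • x'` is `GamΦ`. [folklore] -/
theorem KInv_inr_inl_coarse (κ l : Fin (d + 1)) (x' y : (Fin (d + 1) → ℤ)) :
    KInv (N := N) ((N : ℤ) • x') y (Sum.inr κ) (Sum.inl l) = GamΦ (N := N) κ x' l y := by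
  simp only [KInv, proj_zsmul, if_true, quo_zsmul]

/-- The multiplier–multiplier block at coarse points `N • x'`, `N • y'` is `wΦ`. [folklore] -/
theorem KInv_inr_inr_coarse (κ l : Fin (d + 1)) (x' y' : (Fin (d + 1) → ℤ)) :
    KInv (N := N) ((N : ℤ) • x') ((N : ℤ) • y') (Sum.inr κ) (Sum.inr l) = wΦ (N := N) κ l (x' - y') := by
  simp only [KInv, proj_zsmul, and_self, if_true, quo_zsmul]

/-- Off the coarse sublattice the multiplier legs vanish (second leg). [folklore] -/
theorem KInv_inl_inr_off {y : (Fin (d + 1) → ℤ)} (hy : Torus.proj N y ≠ 0) (κ l : Fin (d + 1)) (x : (Fin (d + 1) → ℤ)) :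
    KInv (N := N) x y (Sum.inl κ) (Sum.inr l) = 0 := by
  simp only [KInv, hy, if_false]

/-- Off the coarse sublattice the multiplier legs vanish (first leg). [folklore] -/
theorem KInv_inr_off {x : (Fin (d + 1) → ℤ)} (hx : Torus.proj N x ≠ 0) (κ : Fin (d + 1)) (b : Fib d) (y : (Fin (d + 1) → ℤ)) :
    KInv (N := N) x y (Sum.inr κ) b = 0 := by
  cases b with
  | inl l => simp only [KInv, hx, if_false]
  | inr l => simp only [KInv, hx, false_and, if_false]

end Defs

/-! ## §2 Exponential decay of the packed kernel (`ExpKernelCalculus.Decays`) -/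

/-- Monotonicity of an exponential bound in the constant and the rate. [folklore] -/
theorem bound_mono {v C C' δ δ' s : ℝ} (h : |v| ≤ C * Real.exp (-δ * s)) (hC0 : 0 ≤ C) (hC : C ≤ C') (hδ : δ' ≤ δ)
    (hs : 0 ≤ s) : |v| ≤ C' * Real.exp (-δ' * s) :=
  h.trans (mul_le_mul hC (Real.exp_le_exp.2 (by nlinarith)) (Real.exp_pos _).le (hC0.trans hC))

/-- A `Decays` bound weakens to a smaller rate and a larger constant. [folklore] -/
theorem decays_mono {F : Type*} {A : ExpKernelCalculus.MKer (d + 1) F} {C C' δ δ' : ℝ} (h : Decays A C δ) (hC0 : 0 ≤ C) (hC : C ≤ C')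
    (hδ : δ' ≤ δ) : Decays A C' δ' :=
  fun x y a b => bound_mono (h x y a b) hC0 hC hδ (l1_nonneg _)

/-- A `BiLoc` bound weakens to a smaller rate. [folklore] -/
theorem biLoc_mono {F : Type*} {K : ExpKernelCalculus.MKer (d + 1) F} {p q : (Fin (d + 1) → ℤ)} {C δ δ' : ℝ} (h : BiLoc K p q C δ) (hC0 : 0 ≤ C)
    (hδ : δ' ≤ δ) : BiLoc K p q C δ' :=
  fun x y a b => bound_mono (h x y a b) hC0 le_rfl hδ (add_nonneg (l1_nonneg _) (l1_nonneg _))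

section Decay

variable [NeZero N]

/-- A point with zero residue is `N` times its block index. [folklore] -/
theorem eq_zsmul_quo_of_proj {x : (Fin (d + 1) → ℤ)} (hx : Torus.proj N x = 0) : x = (N : ℤ) • quo N x := by
  have h := eq_repZ_add_zsmul_quo (N := N) x
  rw [hx, repZ_zero, zero_add] at h
  exact h

/-- `ℓ¹` comparison between a fine separation from a coarse point and the coarse separation:
`|N•q − y|₁ ≤ N |q − quo y|₁ + N (d+1)`. [folklore] -/
theorem l1_zsmul_sub_le (q y : (Fin (d + 1) → ℤ)) :
    l1 ((N : ℤ) • q - y) ≤ (N : ℝ) * l1 (q - quo N y) + (N : ℝ) * (d + 1) := by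
  have hy := eq_repZ_add_zsmul_quo (N := N) y
  have hsplit : (N : ℤ) • q - y = (N : ℤ) • (q - quo N y) - repZ (Torus.proj N y) := by
    conv_lhs => rw [hy]
    rw [smul_sub]
    abel
  rw [hsplit]
  refine (l1_sub_le _ _).trans ?_
  rw [l1_natSmul]
  linarith [l1_repZ_le (N := N) (Torus.proj N y)]

/-- DECAY OF THE `Γ` BLOCK. [folklore] -/
theorem decay_inl_inl : ∃ δ C : ℝ, 0 < δ ∧ 0 ≤ C ∧ ∀ (κ l : Fin (d + 1)) (x y : (Fin (d + 1) → ℤ)),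
    |KInv (N := N) x y (Sum.inl κ) (Sum.inl l)| ≤ C * Real.exp (-δ * l1 (x - y)) := by
  obtain ⟨δ, C, hδ, hC, h⟩ := decay_Gam (N := N) (d := d)
  exact ⟨δ, C, hδ, hC, fun κ l x y => h κ x l y⟩

/-- DECAY OF THE `ℋ` BLOCK. [folklore] -/
theorem decay_inl_inr : ∃ δ C : ℝ, 0 < δ ∧ 0 ≤ C ∧ ∀ (κ l : Fin (d + 1)) (x y : (Fin (d + 1) → ℤ)),
    |KInv (N := N) x y (Sum.inl κ) (Sum.inr l)| ≤ C * Real.exp (-δ * l1 (x - y)) := by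
  obtain ⟨δ, C, hδ, h⟩ := decay_wH (N := N) (d := d)
  have hC : 0 ≤ C := by
    have h0 := h 0 0 0
    simp only [l1, Pi.zero_apply, Int.cast_zero, abs_zero, Finset.sum_const_zero, mul_zero, Real.exp_zero, mul_one] at h0
    exact (abs_nonneg _).trans h0
  refine ⟨δ, C, hδ, hC, fun κ l x y => ?_⟩
  by_cases hy : Torus.proj N y = 0
  · simp only [KInv, hy, if_true]
    exact h κ l (x - y)
  · simp only [KInv, hy, if_false, abs_zero]
    positivity

/-- DECAY OF THE `ℋ♭` BLOCK (rate `δ / N`). [folklore] -/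
theorem decay_inr_inl : ∃ δ C : ℝ, 0 < δ ∧ 0 ≤ C ∧ ∀ (κ l : Fin (d + 1)) (x y : (Fin (d + 1) → ℤ)),
    |KInv (N := N) x y (Sum.inr κ) (Sum.inl l)| ≤ C * Real.exp (-δ * l1 (x - y)) := by
  obtain ⟨δ, C, hδ, hC, h⟩ := decay_wΓφ (N := N) (d := d)
  have hN : (0 : ℝ) < N := by exact_mod_cast Nat.pos_of_ne_zero (NeZero.ne N)
  refine ⟨δ / N, C * Real.exp (δ * (d + 1)), div_pos hδ hN, by positivity, fun κ l x y => ?_⟩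
  by_cases hx : Torus.proj N x = 0
  · simp only [KInv, hx, if_true]
    have hdec : |GamΦ (N := N) κ (quo N x) l y| ≤ C * Real.exp (-δ * l1 (quo N x - quo N y)) := h l (Torus.proj N y) κ _
    have hl1 : l1 (x - y) ≤ (N : ℝ) * l1 (quo N x - quo N y) + (N : ℝ) * (d + 1) := by
      have := l1_zsmul_sub_le (N := N) (quo N x) y
      rwa [← eq_zsmul_quo_of_proj (N := N) hx] at this
    calc |GamΦ (N := N) κ (quo N x) l y| ≤ C * Real.exp (-δ * l1 (quo N x - quo N y)) := hdec
      _ ≤ C * (Real.exp (δ * (d + 1)) * Real.exp (-(δ / N) * l1 (x - y))) := by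
          refine mul_le_mul_of_nonneg_left ?_ hC
          rw [← Real.exp_add]
          refine Real.exp_le_exp.2 ?_
          have h1 : δ / N * l1 (x - y) ≤ δ * l1 (quo N x - quo N y) + δ * (d + 1) := by
            calc δ / N * l1 (x - y) ≤ δ / N * ((N : ℝ) * l1 (quo N x - quo N y) + (N : ℝ) * (d + 1)) :=
                  mul_le_mul_of_nonneg_left hl1 (div_pos hδ hN).le
              _ = δ * l1 (quo N x - quo N y) + δ * (d + 1) := by field_simp
          linarith
      _ = C * Real.exp (δ * (d + 1)) * Real.exp (-(δ / N) * l1 (x - y)) := by ring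
  · simp only [KInv, hx, if_false, abs_zero]
    positivity

/-- DECAY OF THE multiplier–multiplier BLOCK (rate `δ / N`). [folklore] -/
theorem decay_inr_inr : ∃ δ C : ℝ, 0 < δ ∧ 0 ≤ C ∧ ∀ (κ l : Fin (d + 1)) (x y : (Fin (d + 1) → ℤ)),
    |KInv (N := N) x y (Sum.inr κ) (Sum.inr l)| ≤ C * Real.exp (-δ * l1 (x - y)) := by
  obtain ⟨δ, C, hδ, h⟩ := decay_wΦ (N := N) (d := d)
  have hC : 0 ≤ C := by
    have h0 := h 0 0 0
    simp only [l1, Pi.zero_apply, Int.cast_zero, abs_zero, Finset.sum_const_zero, mul_zero, Real.exp_zero, mul_one] at h0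
    exact (abs_nonneg _).trans h0
  have hN : (0 : ℝ) < N := by exact_mod_cast Nat.pos_of_ne_zero (NeZero.ne N)
  refine ⟨δ / N, C, div_pos hδ hN, hC, fun κ l x y => ?_⟩
  by_cases hxy : Torus.proj N x = 0 ∧ Torus.proj N y = 0
  · simp only [KInv, hxy, and_self, if_true]
    have hdec : |wΦ (N := N) κ l (quo N x - quo N y)| ≤ C * Real.exp (-δ * l1 (quo N x - quo N y)) := h κ l _
    have hl1 : l1 (x - y) = (N : ℝ) * l1 (quo N x - quo N y) := by
      conv_lhs => rw [eq_zsmul_quo_of_proj (N := N) hxy.1, eq_zsmul_quo_of_proj (N := N) hxy.2, ← smul_sub]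
      exact l1_natSmul N _
    calc |wΦ (N := N) κ l (quo N x - quo N y)| ≤ C * Real.exp (-δ * l1 (quo N x - quo N y)) := hdec
      _ = C * Real.exp (-(δ / N) * l1 (x - y)) := by
          rw [hl1]
          congr 2
          field_simp
  · simp only [KInv, hxy, if_false, abs_zero]
    positivity

/-- **EXPONENTIAL DECAY OF THE PACKED ONE-STEP RESOLVENT** in the `ExpKernelCalculus.Decays` shape, AT FIXED `N` (rate and
constant existential per `N`; no uniformity in `N` is claimed or needed by the (T-def) slot). [folklore] -/
theorem decays_KInv : ∃ δ C : ℝ, 0 < δ ∧ 0 ≤ C ∧ Decays (KInv (N := N) (d := d)) C δ := by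
  obtain ⟨δ₁, C₁, hδ₁, hC₁, h₁⟩ := decay_inl_inl (N := N) (d := d)
  obtain ⟨δ₂, C₂, hδ₂, hC₂, h₂⟩ := decay_inl_inr (N := N) (d := d)
  obtain ⟨δ₃, C₃, hδ₃, hC₃, h₃⟩ := decay_inr_inl (N := N) (d := d)
  obtain ⟨δ₄, C₄, hδ₄, hC₄, h₄⟩ := decay_inr_inr (N := N) (d := d)
  refine ⟨min (min δ₁ δ₂) (min δ₃ δ₄), C₁ + C₂ + C₃ + C₄, lt_min (lt_min hδ₁ hδ₂) (lt_min hδ₃ hδ₄), by positivity, ?_⟩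
  intro x y a b
  have m1 : min (min δ₁ δ₂) (min δ₃ δ₄) ≤ δ₁ := (min_le_left _ _).trans (min_le_left _ _)
  have m2 : min (min δ₁ δ₂) (min δ₃ δ₄) ≤ δ₂ := (min_le_left _ _).trans (min_le_right _ _)
  have m3 : min (min δ₁ δ₂) (min δ₃ δ₄) ≤ δ₃ := (min_le_right _ _).trans (min_le_left _ _)
  have m4 : min (min δ₁ δ₂) (min δ₃ δ₄) ≤ δ₄ := (min_le_right _ _).trans (min_le_right _ _)
  rcases a with κ | κ <;> rcases b with l | l
  · exact bound_mono (h₁ κ l x y) hC₁ (by linarith) m1 (l1_nonneg _)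
  · exact bound_mono (h₂ κ l x y) hC₂ (by linarith) m2 (l1_nonneg _)
  · exact bound_mono (h₃ κ l x y) hC₃ (by linarith) m3 (l1_nonneg _)
  · exact bound_mono (h₄ κ l x y) hC₄ (by linarith) m4 (l1_nonneg _)

end Decay

/-! ## §3 Block-translation covariance (`BlockCovariant.covA`) and the symmetry of the `Γ` block -/

section Covariance

variable [NeZero N]

/-- **BLOCK-TRANSLATION INVARIANCE**: shifting both legs by a coarse vector `N • t` leaves the packed kernel unchanged —
the `covA` field of `ExpKernelCalculus.BlockCovariant`. [folklore] -/
theorem shiftK_KInv (t : (Fin (d + 1) → ℤ)) : shiftK (-((N : ℤ) • t)) (KInv (N := N) (d := d)) = KInv (N := N) := by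
  have e : ∀ u : (Fin (d + 1) → ℤ), u + -((N : ℤ) • t) = u + (N : ℤ) • (-t) := fun u => by rw [smul_neg]
  have hp : ∀ u : (Fin (d + 1) → ℤ), Torus.proj N (u + -((N : ℤ) • t)) = Torus.proj N u := fun u => by
    rw [e, proj_add_zsmul]
  have hq : ∀ u : (Fin (d + 1) → ℤ), quo N (u + -((N : ℤ) • t)) = quo N u - t := fun u => by
    rw [e, quo_add_zsmul, sub_eq_add_neg]
  funext x y a b
  simp only [shiftK]
  rcases a with κ | κ <;> rcases b with l | l
  · simp only [KInv, Gam, hp, hq]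
    congr 1
    rw [smul_sub]
    abel
  · simp only [KInv, hp, add_sub_add_right_eq_sub]
  · simp only [KInv, GamΦ, hp, hq, sub_sub_sub_cancel_right]
  · simp only [KInv, hp, hq, sub_sub_sub_cancel_right]

/-- `BlockCovariant` for the packed resolvent and ANY block-covariant vertex families. [folklore] -/
theorem blockCovariant_KInv {V : Fin (d + 1) → (Fin (d + 1) → ℤ) → ExpKernelCalculus.MKer (d + 1) (Fib d)}
    {W : Fin (d + 1) → (Fin (d + 1) → ℤ) → Fin (d + 1) → (Fin (d + 1) → ℤ) → ExpKernelCalculus.MKer (d + 1) (Fib d)}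
    (hV : ∀ (μ : Fin (d + 1)) (y t : (Fin (d + 1) → ℤ)), V μ (y + t) = shiftK (-((N : ℤ) • t)) (V μ y))
    (hW : ∀ (μ : Fin (d + 1)) (y : (Fin (d + 1) → ℤ)) (ν : Fin (d + 1)) (y' t : (Fin (d + 1) → ℤ)),
      W μ (y + t) ν (y' + t) = shiftK (-((N : ℤ) • t)) (W μ y ν y')) :
    BlockCovariant (KInv (N := N) (d := d)) V W N :=
  ⟨shiftK_KInv, hV, hW⟩

/-- SYMMETRY OF THE `Γ` BLOCK (`KKTFluctuationEnergy.Gam_symm`). [folklore] -/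
theorem KInv_inl_inl_symm (κ l : Fin (d + 1)) (x y : (Fin (d + 1) → ℤ)) :
    KInv (N := N) x y (Sum.inl κ) (Sum.inl l) = KInv (N := N) y x (Sum.inl l) (Sum.inl κ) := by
  simp only [KInv_inl_inl]
  exact Gam_symm (N := N) _ _ _ _

end Covariance


/-! ## §5 Vertices from local stencils: a bi-localised family superposed with exponentially decaying weights is bi-localised;
the chain-rule vertex `V μ y := Σ_{(κ′,u)} ℋ_{(κ′,u),(μ,y)} · S κ′ u` through the `ℋ`-column of `KInv` -/

section Stencil

variable {D : ℕ} {F : Type*}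

/-- WEIGHTED SUPERPOSITION of a family of kernels indexed by the fine points. [folklore] -/
noncomputable def wsum (w : (Fin D → ℤ) → ℝ) (K : (Fin D → ℤ) → ExpKernelCalculus.MKer D F) : ExpKernelCalculus.MKer D F :=
  fun x z a b => ∑' u : (Fin D → ℤ), w u * K u x z a b

/-- Termwise bound: a weight decaying from `p` times a kernel bi-localised at its own index `u` is
`≤ C·Cₖ·e^{−(δ/2)(|x−p|₁+|z−p|₁)}·e^{−(δ/2)|x−u|₁}`. [folklore] -/
theorem abs_wsumTerm_le {w : (Fin D → ℤ) → ℝ} {K : (Fin D → ℤ) → ExpKernelCalculus.MKer D F} {C Ck δ : ℝ}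
    {p : Fin D → ℤ} (hw : ∀ u, |w u| ≤ C * Real.exp (-δ * l1 (u - p))) (hK : ∀ u, BiLoc (K u) u u Ck δ) (hδ : 0 ≤ δ)
    (hC : 0 ≤ C) (x z : Fin D → ℤ) (a b : F) (u : Fin D → ℤ) :
    |w u * K u x z a b| ≤
      C * Ck * Real.exp (-(δ / 2) * (l1 (x - p) + l1 (z - p))) * Real.exp (-(δ / 2) * l1 (x - u)) := by
  rw [abs_mul]
  have h1 := hw u
  have h2 := hK u x z a b
  have hCk : 0 ≤ Ck := (hK u).nonneg a
  calc |w u| * |K u x z a b|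
      ≤ (C * Real.exp (-δ * l1 (u - p))) * (Ck * Real.exp (-δ * (l1 (x - u) + l1 (z - u)))) :=
        mul_le_mul h1 h2 (abs_nonneg _) ((abs_nonneg _).trans h1)
    _ = C * Ck * Real.exp (-δ * l1 (u - p) + -δ * (l1 (x - u) + l1 (z - u))) := by rw [Real.exp_add]; ring
    _ ≤ C * Ck * Real.exp (-(δ / 2) * (l1 (x - p) + l1 (z - p)) + -(δ / 2) * l1 (x - u)) := by
        refine mul_le_mul_of_nonneg_left (Real.exp_le_exp.2 ?_) (mul_nonneg hC hCk)
        have tx : l1 (x - p) ≤ l1 (x - u) + l1 (u - p) := l1_sub_triangle x u p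
        have tz : l1 (z - p) ≤ l1 (z - u) + l1 (u - p) := l1_sub_triangle z u p
        nlinarith [mul_nonneg hδ (show 0 ≤ l1 (x - u) + l1 (u - p) - l1 (x - p) by linarith),
          mul_nonneg hδ (show 0 ≤ l1 (z - u) + l1 (u - p) - l1 (z - p) by linarith), mul_nonneg hδ (l1_nonneg (z - u))]
    _ = _ := by rw [Real.exp_add]; ring

/-- Summability of the weighted superposition series. [folklore] -/
theorem summable_wsumTerm {w : (Fin D → ℤ) → ℝ} {K : (Fin D → ℤ) → ExpKernelCalculus.MKer D F} {C Ck δ : ℝ}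
    {p : Fin D → ℤ} (hw : ∀ u, |w u| ≤ C * Real.exp (-δ * l1 (u - p))) (hK : ∀ u, BiLoc (K u) u u Ck δ) (hδ : 0 < δ)
    (hC : 0 ≤ C) (x z : Fin D → ℤ) (a b : F) : Summable fun u : Fin D → ℤ => w u * K u x z a b := by
  refine Summable.of_norm_bounded ((summable_exp_shift (half_pos hδ) x).mul_left
    (C * Ck * Real.exp (-(δ / 2) * (l1 (x - p) + l1 (z - p))))) (fun u => ?_)
  rw [Real.norm_eq_abs]
  exact abs_wsumTerm_le hw hK hδ.le hC x z a b u

/-- **DECAYING WEIGHTS × SELF-LOCALISED STENCILS ⇒ BI-LOCALISED** at the centre of the weights (rate `δ/2`, constant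
`C·Cₖ·Zl(δ/2)`). [folklore] -/
theorem biLoc_wsum {w : (Fin D → ℤ) → ℝ} {K : (Fin D → ℤ) → ExpKernelCalculus.MKer D F} {C Ck δ : ℝ} {p : Fin D → ℤ}
    (hw : ∀ u, |w u| ≤ C * Real.exp (-δ * l1 (u - p))) (hK : ∀ u, BiLoc (K u) u u Ck δ) (hδ : 0 < δ) (hC : 0 ≤ C) :
    BiLoc (wsum w K) p p (C * Ck * Zl D (δ / 2)) (δ / 2) := by
  intro x z a b
  unfold wsum
  have hs := summable_exp_shift (half_pos hδ) x
  have hmaj := hs.mul_left (C * Ck * Real.exp (-(δ / 2) * (l1 (x - p) + l1 (z - p))))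
  have hb := tsum_of_norm_bounded hmaj.hasSum
    (fun u => by rw [Real.norm_eq_abs]; exact abs_wsumTerm_le hw hK hδ.le hC x z a b u)
  rw [Real.norm_eq_abs] at hb
  refine hb.trans (le_of_eq ?_)
  rw [tsum_mul_left, tsum_exp_shift]
  ring

/-- Bi-localisation is additive over a finite family (constants add). [folklore] -/
theorem biLoc_finset_sum {ι : Type*} (s : Finset ι) {K : ι → ExpKernelCalculus.MKer D F} {C : ι → ℝ} {δ : ℝ}
    {p q : Fin D → ℤ} (h : ∀ i ∈ s, BiLoc (K i) p q (C i) δ) :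
    BiLoc (fun x z a b => ∑ i ∈ s, K i x z a b) p q (∑ i ∈ s, C i) δ := by
  intro x z a b
  calc |∑ i ∈ s, K i x z a b| ≤ ∑ i ∈ s, |K i x z a b| := Finset.abs_sum_le_sum_abs _ _
    _ ≤ ∑ i ∈ s, C i * Real.exp (-δ * (l1 (x - p) + l1 (z - q))) := Finset.sum_le_sum fun i hi => h i hi x z a b
    _ = (∑ i ∈ s, C i) * Real.exp (-δ * (l1 (x - p) + l1 (z - q))) := by rw [Finset.sum_mul]

/-- Shifting the index of a fine-translation-covariant stencil family shifts the superposition. [folklore] -/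
theorem wsum_shift (w : (Fin D → ℤ) → ℝ) {K : (Fin D → ℤ) → ExpKernelCalculus.MKer D F} (v : Fin D → ℤ)
    (hK : ∀ u, K (u + v) = shiftK (-v) (K u)) :
    wsum (fun u => w (u - v)) K = shiftK (-v) (wsum w K) := by
  funext x z a b
  simp only [wsum, shiftK]
  rw [← tsum_shift (fun u => w (u - v) * K u x z a b) v]
  refine tsum_congr (fun u => ?_)
  rw [add_sub_cancel_right, hK u]
  rfl

end Stencil

section Vertex

variable [NeZero N]

/-- A LOCAL STENCIL FAMILY for the first `B`-jet: `S κ′ u` = the derivative of the bordered operator with respect to the fine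
gauge-field component `(κ′, u)` at `U = 1`, a kernel (bi-)localised at `u` itself (finite range in Bałaban's case; exponential
localisation is all that is used). [folklore] -/
def LocStencil (S : Fin (d + 1) → (Fin (d + 1) → ℤ) → ExpKernelCalculus.MKer (d + 1) (Fib d)) (Cs δ : ℝ) : Prop :=
  ∀ κ' u, BiLoc (S κ' u) u u Cs δ

/-- **THE CHAIN-RULE VERTEX** through the `ℋ`-column of the packed resolvent: the first `B`-jet at the coarse bond `(μ, y)` of a
bordered operator depending on the background only through the fine field, `V μ y := Σ'_u Σ_{κ′} ℋ_{(κ′,u),(μ,y)} · S κ′ u` with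
`ℋ_{(κ′,u),(μ,y)} = KInv u (N•y) (inl κ′) (inr μ) = wH κ′ μ (u − N•y)` (the linear response of the background minimiser to the
coarse field). [folklore] -/
noncomputable def vertexOf (S : Fin (d + 1) → (Fin (d + 1) → ℤ) → ExpKernelCalculus.MKer (d + 1) (Fib d)) (μ : Fin (d + 1))
    (y : Fin (d + 1) → ℤ) : ExpKernelCalculus.MKer (d + 1) (Fib d) :=
  fun x z a b => ∑ κ' : Fin (d + 1), wsum (fun u => wH (N := N) κ' μ (u - (N : ℤ) • y)) (S κ') x z a b

/-- The weights of the chain-rule vertex are the `ℋ`-entries of the packed resolvent. [folklore] -/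
theorem vertexOf_weight (κ' μ : Fin (d + 1)) (u y : Fin (d + 1) → ℤ) :
    wH (N := N) κ' μ (u - (N : ℤ) • y) = KInv (N := N) u ((N : ℤ) • y) (Sum.inl κ') (Sum.inr μ) :=
  (KInv_inl_inr_coarse (N := N) κ' μ u y).symm

/-- **THE CHAIN-RULE VERTEX IS A VERTEX FAMILY**: for a local stencil family with rate `δ ≤` the decay rate of `wH`, `vertexOf S`
is bi-localised at the coarse bonds with rate `δ/2` — the hypothesis `VertexFamily` of `ExpKernelCalculus.absMoment₂_hessKer` /
`absMoment₂_hessKer_KInv`. [folklore] -/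
theorem vertexFamily_vertexOf {S : Fin (d + 1) → (Fin (d + 1) → ℤ) → ExpKernelCalculus.MKer (d + 1) (Fib d)} {Cs δ : ℝ}
    (hS : LocStencil S Cs δ) (hδ : 0 < δ) {Cw δw : ℝ} (hCw : 0 ≤ Cw) (hδw : δ ≤ δw)
    (hwH : ∀ κ l : Fin (d + 1), Decay510 (wH (N := N) κ l) Cw δw) :
    VertexFamily (vertexOf (N := N) S) N ((d + 1 : ℕ) * (Cw * Cs * Zl (d + 1) (δ / 2))) (δ / 2) := by
  intro μ y
  have hterm : ∀ κ' : Fin (d + 1), BiLoc (wsum (fun u => wH (N := N) κ' μ (u - (N : ℤ) • y)) (S κ'))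
      ((N : ℤ) • y) ((N : ℤ) • y) (Cw * Cs * Zl (d + 1) (δ / 2)) (δ / 2) := by
    intro κ'
    refine biLoc_wsum (fun u => ?_) (fun u => hS κ' u) hδ hCw
    exact bound_mono (hwH κ' μ (u - (N : ℤ) • y)) hCw le_rfl hδw (l1_nonneg _)
  have hsum := biLoc_finset_sum (Finset.univ : Finset (Fin (d + 1))) (fun κ' _ => hterm κ')
  simp only [Finset.sum_const, Finset.card_univ, Fintype.card_fin, nsmul_eq_mul] at hsum
  exact hsum

/-- The packaged form: SOME constant and the rate `δ/2 ∧ …` work (rate of `wH` matched by monotonicity). [folklore] -/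
theorem vertexFamily_vertexOf' {S : Fin (d + 1) → (Fin (d + 1) → ℤ) → ExpKernelCalculus.MKer (d + 1) (Fib d)} {Cs δ : ℝ}
    (hS : LocStencil S Cs δ) (hδ : 0 < δ) :
    ∃ Cv δv : ℝ, 0 < δv ∧ VertexFamily (vertexOf (N := N) S) N Cv δv := by
  obtain ⟨δw, Cw, hδw, hwH⟩ := decay_wH (N := N) (d := d)
  have hCw : 0 ≤ Cw := by
    have h0 := hwH 0 0 0
    simp only [l1, Pi.zero_apply, Int.cast_zero, abs_zero, Finset.sum_const_zero, mul_zero, Real.exp_zero, mul_one] at h0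
    exact (abs_nonneg _).trans h0
  have hCs : 0 ≤ Cs := (hS 0 0).nonneg (Sum.inl 0)
  have hS' : LocStencil S Cs (min δ δw) := fun κ' u => biLoc_mono (hS κ' u) hCs (min_le_left _ _)
  exact ⟨_, _, half_pos (lt_min hδ hδw), vertexFamily_vertexOf (N := N) hS' (lt_min hδ hδw) hCw (min_le_right _ _) hwH⟩

/-- **COVARIANCE OF THE CHAIN-RULE VERTEX** (`BlockCovariant.covV`) for a fine-translation-covariant stencil family. [folklore] -/
theorem vertexOf_translate {S : Fin (d + 1) → (Fin (d + 1) → ℤ) → ExpKernelCalculus.MKer (d + 1) (Fib d)}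
    (hS : ∀ (κ' : Fin (d + 1)) (u v : Fin (d + 1) → ℤ), S κ' (u + v) = shiftK (-v) (S κ' u)) (μ : Fin (d + 1))
    (y t : Fin (d + 1) → ℤ) : vertexOf (N := N) S μ (y + t) = shiftK (-((N : ℤ) • t)) (vertexOf (N := N) S μ y) := by
  funext x z a b
  simp only [vertexOf]
  have h : ∀ κ' : Fin (d + 1), wsum (fun u => wH (N := N) κ' μ (u - (N : ℤ) • (y + t))) (S κ') =
      shiftK (-((N : ℤ) • t)) (wsum (fun u => wH (N := N) κ' μ (u - (N : ℤ) • y)) (S κ')) := by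
    intro κ'
    have hw : (fun u => wH (N := N) κ' μ (u - (N : ℤ) • (y + t))) =
        fun u => (fun u' => wH (N := N) κ' μ (u' - (N : ℤ) • y)) (u - (N : ℤ) • t) := by
      funext u
      simp only [smul_add]
      congr 1
      abel
    rw [hw]
    exact wsum_shift (fun u' => wH (N := N) κ' μ (u' - (N : ℤ) • y)) ((N : ℤ) • t) (fun u => hS κ' u ((N : ℤ) • t))
  simp only [h, shiftK, vertexOf]

end Vertex

/-! ## §6 The (T-def) `A`-slot is closed: `AbsMoment₂` of `hessKer (KInv N) V W` for every admissible vertex pair -/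

section Hess

variable [NeZero N]

/-- **THE ONE-STEP RESOLVENT HESSIAN KERNEL IS WELL-TYPED FOR EVERY VERTEX PAIR**: for any first- and second-order vertex families
`(V, W)` on the fibre `Fib d`, bi-localised at the coarse bonds with some rate `δv > 0`, every entry of
`hessKer (KInv N) V W` has absolutely summable second moments — the hypothesis `hTA` of `HidentScalewise` /
`ScalewiseVectorSeam` for `𝒯 := hessKer (KInv N) V W` (rates matched by monotonicity to `min δ_A δv`). [folklore] -/
theorem absMoment₂_hessKer_KInv {V : Fin (d + 1) → (Fin (d + 1) → ℤ) → ExpKernelCalculus.MKer (d + 1) (Fib d)}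
    {W : Fin (d + 1) → (Fin (d + 1) → ℤ) → Fin (d + 1) → (Fin (d + 1) → ℤ) → ExpKernelCalculus.MKer (d + 1) (Fib d)} {Cv Cw δv : ℝ}
    (hV : VertexFamily V N Cv δv) (hW : VertexFamily₂ W N Cw δv) (hδv : 0 < δv) (μ ν : Fin (d + 1)) :
    AbsMoment₂ (hessKer (KInv (N := N) (d := d)) V W μ ν) := by
  obtain ⟨δ, C, hδ, hC, hA⟩ := decays_KInv (N := N) (d := d)
  have hCv : 0 ≤ Cv := (hV μ 0).nonneg (Sum.inl 0)
  have hCw : 0 ≤ Cw := (hW μ 0 ν 0).nonneg (Sum.inl 0)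
  have hA' : Decays (KInv (N := N) (d := d)) C (min δ δv) := decays_mono hA hC le_rfl (min_le_left _ _)
  have hV' : VertexFamily V N Cv (min δ δv) := fun μ' y => biLoc_mono (hV μ' y) hCv (min_le_right _ _)
  have hW' : VertexFamily₂ W N Cw (min δ δv) := fun μ' y ν' y' => biLoc_mono (hW μ' y ν' y') hCw (min_le_right _ _)
  exact absMoment₂_hessKer hA' hV' hW' (lt_min hδ hδv) (Nat.one_le_iff_ne_zero.2 (NeZero.ne N)) μ ν

/-- With block-covariant vertex families the base point is immaterial: `hess (KInv N) V W μ y ν y′ = hessKer (KInv N) V W μ ν (y′ − y)`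
(`ExpKernelCalculus.hess_eq_hessKer` with `covA := shiftK_KInv`). [folklore] -/
theorem hess_KInv_eq_hessKer {V : Fin (d + 1) → (Fin (d + 1) → ℤ) → ExpKernelCalculus.MKer (d + 1) (Fib d)}
    {W : Fin (d + 1) → (Fin (d + 1) → ℤ) → Fin (d + 1) → (Fin (d + 1) → ℤ) → ExpKernelCalculus.MKer (d + 1) (Fib d)}
    (hV : ∀ (μ : Fin (d + 1)) (y t : (Fin (d + 1) → ℤ)), V μ (y + t) = shiftK (-((N : ℤ) • t)) (V μ y))
    (hW : ∀ (μ : Fin (d + 1)) (y : (Fin (d + 1) → ℤ)) (ν : Fin (d + 1)) (y' t : (Fin (d + 1) → ℤ)),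
      W μ (y + t) ν (y' + t) = shiftK (-((N : ℤ) • t)) (W μ y ν y'))
    (μ : Fin (d + 1)) (y : (Fin (d + 1) → ℤ)) (ν : Fin (d + 1)) (y' : (Fin (d + 1) → ℤ)) :
    hess (KInv (N := N) (d := d)) V W μ y ν y' = hessKer (KInv (N := N) (d := d)) V W μ ν (y' - y) :=
  hess_eq_hessKer (blockCovariant_KInv hV hW) μ y ν y'

end Hess


/-! ## §7 Jet data and the typed one-step kernel: the `hTA` slot of the endpoint theorems, in any dimension and in dimension four -/

section Jet

/-- FIRST- AND SECOND-ORDER JET DATA of a bordered operator family over the typed `U = 1` system at blocking `N`: a local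
first-order STENCIL family `S` (the derivative in the fine field, localised at its own bond, rate `δ`) and an abstract second-order
VERTEX family `W` bi-localised at the coarse bonds (same rate).  Bałaban's actual jets (Wilson Hessian, linearised averaging,
`J`-term) are NOT constructed here; this structure is the socket they are to be delivered into. [folklore] -/
structure JetData (d N : ℕ) where
  /-- first-order stencil family `S κ′ u` -/
  S : Fin (d + 1) → (Fin (d + 1) → ℤ) → ExpKernelCalculus.MKer (d + 1) (Fib d)
  /-- second-order vertex family `W μ y ν y′` -/
  W : Fin (d + 1) → (Fin (d + 1) → ℤ) → Fin (d + 1) → (Fin (d + 1) → ℤ) → ExpKernelCalculus.MKer (d + 1) (Fib d)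
  /-- stencil constant -/
  Cs : ℝ
  /-- second-order constant -/
  Cw : ℝ
  /-- common localisation rate -/
  δ : ℝ
  δ_pos : 0 < δ
  loc : LocStencil S Cs δ
  loc₂ : VertexFamily₂ W N Cw δ

variable [NeZero N]

/-- **THE TYPED KERNEL OF A JET DATUM** (blocking `N`): `T := hessKer (KInv N) (vertexOf S) W` — the resolvent Hessian kernel of
the typed `U = 1` system with the chain-rule first-order vertex and the given second-order vertex. [folklore] -/
noncomputable def TOf (J : JetData d N) : Fin (d + 1) → Fin (d + 1) → (Fin (d + 1) → ℤ) → ℝ :=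
  hessKer (KInv (N := N) (d := d)) (vertexOf (N := N) J.S) J.W

/-- Every entry of the typed kernel of a jet datum has absolutely summable second moments. [folklore] -/
theorem absMoment₂_TOf (J : JetData d N) (μ ν : Fin (d + 1)) : AbsMoment₂ (TOf (N := N) J μ ν) := by
  obtain ⟨Cv, δv, hδv, hV⟩ := vertexFamily_vertexOf' (N := N) J.loc J.δ_pos
  have hCv : 0 ≤ Cv := (hV μ 0).nonneg (Sum.inl 0)
  have hCw : 0 ≤ J.Cw := (J.loc₂ μ 0 ν 0).nonneg (Sum.inl 0)
  have hV' : VertexFamily (vertexOf (N := N) J.S) N Cv (min δv J.δ) := fun μ' y => biLoc_mono (hV μ' y) hCv (min_le_left _ _)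
  have hW' : VertexFamily₂ J.W N J.Cw (min δv J.δ) := fun μ' y ν' y' => biLoc_mono (J.loc₂ μ' y ν' y') hCw (min_le_right _ _)
  exact absMoment₂_hessKer_KInv (N := N) hV' hW' (lt_min hδv J.δ_pos) μ ν

/-- **THE `hTA` SLOT IN DIMENSION FOUR**: for any scale-indexed family of jet data over the typed `U = 1` systems (`d + 1 = 4`,
blocking `Nf j` at index `j` — e.g. `Nf j = L^(j+1)` for composite one-step data or `Nf m = L^m` for one-shot data), the family of
typed kernels `j ↦ TOf (J j) : ℕ → EKer 4` (`EKer 4 = Fin 4 → Fin 4 → (Fin 4 → ℤ) → ℝ`,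
`Beta.DressedMomentNormalisation`, not imported here) satisfies the hypothesis `hTA : ∀ j c e, AbsMoment₂ (T j c e)` of
`HidentScalewise.endpointExistence_of_scalewise_remainderConst` / `ScalewiseVectorSeam.endpointExistence_of_scalewise_vectorSeam`.
[folklore] -/
theorem hTA_TOf {Nf : ℕ → ℕ} [∀ j, NeZero (Nf j)] (J : ∀ j : ℕ, JetData 3 (Nf j)) :
    ∀ (j : ℕ) (c e : Fin 4), AbsMoment₂ ((fun j => (TOf (N := Nf j) (J j) : Fin 4 → Fin 4 → (Fin 4 → ℤ) → ℝ)) j c e) :=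
  fun j c e => absMoment₂_TOf (N := Nf j) (J j) c e

end Jet

end Literature.MathematicalPhysics.QuantumFieldTheory.Balaban1983to89.Beta.OneStepResolventKernel
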